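import Summits.ResolutionOfSingularities.ResolutionOfSingularities.Theorems.WeightedInvariantLocalWeightedDropNCToricRungClosed

/-!
# TOT rung R6, corollary: TAME BRIESKORN–PHAM GERMS `Σᵢ uᵢ·xᵢ^{aᵢ}` (`p ∤ aᵢ`) are Newton non-degenerate, hence won, in every dimension

Crux item stmt-ResolutionOfSingularities-8899 `WeightedInvariant.LocalWeightedDrop` (route `ResolutionOfSingularities/WeightedInvariant`), line
`nc-game-transport`, TOT rung R6 `NCTransport.totRungNonDegenerate` (`…NCToricRungClosed`).  [OURS · L1 W4.3 · seat res-D-pv-006; def-free; NOT a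
statement of any manuscript.]

A (unit-coefficient) BRIESKORN–PHAM GERM in `m + 1` variables is `b = Σᵢ uᵢ · xᵢ^{aᵢ}` with units `uᵢ` (`uᵢ(0) ≠ 0`) and exponents `aᵢ ≥ 1`;
it is TAME when every `aᵢ` is invertible in `k` (`p ∤ aᵢ`).  For every positive weight `w` its initial form is `Σ_{i ∈ I(w)} uᵢ(0)·xᵢ^{aᵢ}`
(`I(w)` = the minimisers of `wᵢaᵢ`) and the EULER CERTIFICATE `x_t∂_t (in_w b) = a_t·u_t(0)·x_t^{a_t}` (`t ∈ I(w)`) puts a power of a variable in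
the log-Jacobian ideal — so tame Brieskorn–Pham germs are Newton non-degenerate (`newtonNonDegenerate_brieskornPham`) and, by R6, every such germ
over an algebraically closed field of characteristic `p ∤ ∏ aᵢ`, together with every divisor of its powers, is `CobordantGame.Won k (m + 1)`
(`won_brieskornPham`, `won_of_dvd_brieskornPham_pow`) — a classical specimen family (Fermat hypersurfaces, `E₆ / E₈`-type points
`z² + y³ + x⁴`, `z² + y³ + x⁵` away from characteristics `2, 3, 5`, …) in EVERY dimension, with no surface-resolution input.
Wild exponents (`p ∣ aᵢ`) are correctly excluded: `x₀^p + x₁^p = (x₀ + x₁)^p` is not even reduced.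
-/

set_option linter.dupNamespace false -- mandated namespace of this single-conjunct summit

namespace Summit.ResolutionOfSingularities.ResolutionOfSingularities.Theorems

namespace NCTransport

open MvPowerSeries Literature.AlgebraicGeometry.Resolution TameFourTupleDrop

variable {k : Type} [Field k]

/-- A POWER OF A VARIABLE IN THE LOG-JACOBIAN IDEAL certifies torus-smoothness: `(∏ X_j)^a = X_t^a · ∏_{j ≠ t} X_j^a`. -/
theorem torusSmooth_of_X_pow_mem {n : ℕ} {g : MvPowerSeries (Fin n) k} (t : Fin n) (a : ℕ)
    (h : (X t : MvPowerSeries (Fin n) k) ^ a ∈ Ideal.span (insert g (Set.range fun i => eulerOp i g))) : TorusSmooth g := by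
  classical
  refine ⟨a, ?_⟩
  rw [← Finset.prod_pow, ← Finset.mul_prod_erase Finset.univ (fun j => (X j : MvPowerSeries (Fin n) k) ^ a) (Finset.mem_univ t)]
  exact Ideal.mul_mem_right _ _ h

/-- The coefficients of a Brieskorn–Pham germ `Σᵢ uᵢ·xᵢ^{aᵢ}`. -/
theorem coeff_brieskornPham {n : ℕ} (u : Fin n → MvPowerSeries (Fin n) k) (a : Fin n → ℕ) (d : Fin n →₀ ℕ) :
    coeff d (∑ i, u i * X i ^ a i) = ∑ i, if Finsupp.single i (a i) ≤ d then coeff (d - Finsupp.single i (a i)) (u i) else 0 := by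
  classical
  rw [map_sum]
  refine Finset.sum_congr rfl fun i _ => ?_
  rw [X_pow_eq, coeff_mul_monomial, mul_one]

/-- The coefficient of a Brieskorn–Pham germ with positive exponents at `x_t^{a_t}` is `u_t(0)`. -/
theorem coeff_brieskornPham_single {n : ℕ} (u : Fin n → MvPowerSeries (Fin n) k) {a : Fin n → ℕ} (ha : ∀ i, 0 < a i) (t : Fin n) :
    coeff (Finsupp.single t (a t)) (∑ i, u i * X i ^ a i) = constantCoeff (u t) := by
  classical
  rw [coeff_brieskornPham, Finset.sum_eq_single t]
  · rw [if_pos le_rfl, tsub_self, coeff_zero_eq_constantCoeff_apply]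
  · intro i _ hit
    rw [if_neg]
    intro hle
    have h1 := hle i
    rw [Finsupp.single_eq_same, Finsupp.single_apply, if_neg (Ne.symm hit)] at h1
    exact absurd (ha i) (not_lt.mpr h1)
  · exact fun h => absurd (Finset.mem_univ t) h

/-- Every exponent in the support of a Brieskorn–Pham germ dominates some `a_i·e_i`. -/
theorem exists_single_le_of_coeff_brieskornPham_ne_zero {n : ℕ} (u : Fin n → MvPowerSeries (Fin n) k) (a : Fin n → ℕ)
    {d : Fin n →₀ ℕ} (hd : coeff d (∑ i, u i * X i ^ a i) ≠ 0) : ∃ i, Finsupp.single i (a i) ≤ d := by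
  classical
  rw [coeff_brieskornPham] at hd
  obtain ⟨i, -, hi⟩ := Finset.exists_ne_zero_of_sum_ne_zero hd
  by_cases h : Finsupp.single i (a i) ≤ d
  · exact ⟨i, h⟩
  · rw [if_neg h] at hi
    exact absurd rfl hi

/-- **TAME BRIESKORN–PHAM GERMS ARE NEWTON NON-DEGENERATE**: `Σᵢ uᵢ·xᵢ^{aᵢ}` with units `uᵢ`, exponents `aᵢ ≥ 1` invertible in `k`. -/
theorem newtonNonDegenerate_brieskornPham {m : ℕ} (u : Fin (m + 1) → MvPowerSeries (Fin (m + 1)) k) (hu : ∀ i, constantCoeff (u i) ≠ 0)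
    {a : Fin (m + 1) → ℕ} (ha : ∀ i, 0 < a i) (hak : ∀ i, ((a i : ℕ) : k) ≠ 0) :
    NewtonNonDegenerate (∑ i, u i * X i ^ a i) := by
  classical
  intro w hw
  obtain ⟨b, hb⟩ : ∃ b : MvPowerSeries (Fin (m + 1)) k, b = ∑ i, u i * X i ^ a i := ⟨_, rfl⟩
  rw [← hb]
  -- a minimiser `t` of `wᵢ·aᵢ` and the minimum `μ`
  obtain ⟨t, -, ht⟩ := Finset.exists_min_image Finset.univ (fun i => w i * a i) Finset.univ_nonempty
  set μ := w t * a t with hμ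
  have hweight_single : ∀ i, Finsupp.weight w (Finsupp.single i (a i)) = w i * a i := fun i => by
    rw [Finsupp.weight_single, smul_eq_mul, mul_comm]
  have hle_weight : ∀ {d : Fin (m + 1) →₀ ℕ} {i}, Finsupp.single i (a i) ≤ d → w i * a i ≤ Finsupp.weight w d := by
    intro d i h
    rw [← hweight_single, ← add_tsub_cancel_of_le h, map_add]
    exact Nat.le_add_right _ _
  have hlow : ∀ d, Finsupp.weight w d < μ → coeff d b = 0 := by
    intro d hd
    by_contra hne
    obtain ⟨i, hi⟩ := exists_single_le_of_coeff_brieskornPham_ne_zero u a (hb ▸ hne)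
    exact absurd (lt_of_le_of_lt ((ht i (Finset.mem_univ i)).trans (hle_weight hi)) hd) (lt_irrefl _)
  have hcoefft : coeff (Finsupp.single t (a t)) b = constantCoeff (u t) := by rw [hb]; exact coeff_brieskornPham_single u ha t
  have horder : weightedOrder w b = μ :=
    (weightedOrder_eq_nat w).mpr ⟨⟨Finsupp.single t (a t), by rw [hcoefft]; exact hu t, hweight_single t⟩, hlow⟩
  -- the Euler certificate at `t`: `x_t∂_t (in_w b) = a_t·u_t(0)·x_t^{a_t}`
  have heuler : eulerOp t (initForm w b) = monomial (Finsupp.single t (a t)) (((a t : ℕ) : k) * constantCoeff (u t)) := by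
    ext d
    rw [coeff_monomial]
    change ((d t : ℕ) : k) * coeff d (initForm w b) = _
    change ((d t : ℕ) : k) * (if ((Finsupp.weight w d : ℕ) : ℕ∞) = weightedOrder w b then coeff d b else 0) = _
    rw [horder]
    simp only [Nat.cast_inj]
    by_cases hdt : d = Finsupp.single t (a t)
    · subst hdt
      rw [if_pos (hweight_single t), if_pos rfl, hcoefft, Finsupp.single_eq_same]
    · rw [if_neg hdt]
      by_cases hwd : Finsupp.weight w d = μ
      · rw [if_pos hwd]
        by_cases hdt0 : d t = 0
        · rw [hdt0, Nat.cast_zero, zero_mul]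
        · -- `d_t ≠ 0`, weight `μ`, `d ≠ a_t e_t`: no support there
          suffices hzero : coeff d b = 0 by rw [hzero, mul_zero]
          by_contra hne
          obtain ⟨i, hi⟩ := exists_single_le_of_coeff_brieskornPham_ne_zero u a (hb ▸ hne)
          by_cases hit : i = t
          · subst hit
            -- `a_t e_t ≤ d`, `d ≠ a_t e_t` ⇒ weight `> μ`
            have hlt : Finsupp.weight w (Finsupp.single i (a i)) < Finsupp.weight w d := by
              have hd' : d = Finsupp.single i (a i) + (d - Finsupp.single i (a i)) := (add_tsub_cancel_of_le hi).symm
              have hne' : d - Finsupp.single i (a i) ≠ 0 := by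
                intro h0; apply hdt; rw [hd', h0, add_zero]
              obtain ⟨s, hs⟩ : ∃ s, (d - Finsupp.single i (a i)) s ≠ 0 := by
                by_contra h
                exact hne' (Finsupp.ext fun s => not_not.mp (not_exists.mp h s))
              have hpos : 0 < Finsupp.weight w (d - Finsupp.single i (a i)) :=
                lt_of_lt_of_le (hw s) (Finsupp.le_weight_of_ne_zero' (w := w) hs)
              rw [hd', map_add]
              omega
            rw [hweight_single] at hlt
            exact absurd hwd (ne_of_gt hlt)
          · -- `a_i e_i ≤ d` with `i ≠ t` and `d_t ≥ 1` ⇒ weight `≥ wᵢaᵢ + w_t > μ`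
            have hsum : Finsupp.single i (a i) + Finsupp.single t 1 ≤ d := by
              intro s
              have h1 := hi s
              rw [Finsupp.single_apply] at h1
              rw [Finsupp.add_apply, Finsupp.single_apply, Finsupp.single_apply]
              by_cases hsi : i = s
              · by_cases hst : t = s
                · exact absurd (hsi.trans hst.symm) hit
                · rw [if_pos hsi, if_neg hst, add_zero]; rw [if_pos hsi] at h1; exact h1
              · by_cases hst : t = s
                · rw [if_neg hsi, if_pos hst, zero_add, ← hst]; omega
                · rw [if_neg hsi, if_neg hst, add_zero]; exact Nat.zero_le _
            have hge : w i * a i + w t ≤ Finsupp.weight w d := by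
              have := hle_weight (i := i) (d := d) hi
              rw [← add_tsub_cancel_of_le hsum, map_add, map_add, hweight_single, Finsupp.weight_single, smul_eq_mul, one_mul]
              omega
            have := ht i (Finset.mem_univ i)
            have hwt := hw t
            omega
      · rw [if_neg hwd, mul_zero]
  have hmono : (X t : MvPowerSeries (Fin (m + 1)) k) ^ a t =
      C ((((a t : ℕ) : k) * constantCoeff (u t)))⁻¹ * eulerOp t (initForm w b) := by
    rw [heuler, ← monomial_zero_eq_C_apply, monomial_mul_monomial, zero_add, inv_mul_cancel₀ (mul_ne_zero (hak t) (hu t)), X_pow_eq]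
  refine torusSmooth_of_X_pow_mem t (a t) ?_
  rw [hmono]
  exact Ideal.mul_mem_left _ _ (Ideal.subset_span (Set.mem_insert_of_mem _ (Set.mem_range_self t)))

/-- A Brieskorn–Pham germ with positive exponents is non-zero. -/
theorem brieskornPham_ne_zero {m : ℕ} (u : Fin (m + 1) → MvPowerSeries (Fin (m + 1)) k) (hu : ∀ i, constantCoeff (u i) ≠ 0)
    {a : Fin (m + 1) → ℕ} (ha : ∀ i, 0 < a i) : (∑ i, u i * X i ^ a i) ≠ 0 := by
  intro h
  have := coeff_brieskornPham_single u ha 0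
  rw [h, map_zero] at this
  exact hu 0 this.symm

/-- **TAME BRIESKORN–PHAM GERMS ARE WON, IN EVERY DIMENSION**: over an algebraically closed field of characteristic `p`, a germ
`Σᵢ uᵢ·xᵢ^{aᵢ}` in `m + 1` variables with units `uᵢ` and exponents `aᵢ ≥ 1`, `p ∤ aᵢ`, is `CobordantGame.Won k (m + 1)`. -/
theorem won_brieskornPham {m : ℕ} (p : ℕ) (hp : p.Prime) (k : Type) [Field k] [CharP k p] [IsAlgClosed k]
    (u : Fin (m + 1) → MvPowerSeries (Fin (m + 1)) k) (hu : ∀ i, constantCoeff (u i) ≠ 0) (a : Fin (m + 1) → ℕ) (ha : ∀ i, 0 < a i)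
    (hak : ∀ i, ((a i : ℕ) : k) ≠ 0) : CobordantGame.Won k (m + 1) (∑ i, u i * X i ^ a i) :=
  won_of_newtonNonDegenerate p hp k _ (brieskornPham_ne_zero u hu ha) (newtonNonDegenerate_brieskornPham u hu ha hak)

/-- … and so is every divisor of each of its powers. -/
theorem won_of_dvd_brieskornPham_pow {m : ℕ} (p : ℕ) (hp : p.Prime) (k : Type) [Field k] [CharP k p] [IsAlgClosed k]
    (u : Fin (m + 1) → MvPowerSeries (Fin (m + 1)) k) (hu : ∀ i, constantCoeff (u i) ≠ 0) (a : Fin (m + 1) → ℕ) (ha : ∀ i, 0 < a i)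
    (hak : ∀ i, ((a i : ℕ) : k) ≠ 0) (N : ℕ) (f : MvPowerSeries (Fin (m + 1)) k) (hf : f ∣ (∑ i, u i * X i ^ a i) ^ (N + 1)) :
    CobordantGame.Won k (m + 1) f :=
  won_of_dvd_pow_of_newtonNonDegenerate p hp k _ (brieskornPham_ne_zero u hu ha) (newtonNonDegenerate_brieskornPham u hu ha hak) N f hf

/-- The finite-round form: tame Brieskorn–Pham germs are won by the mover of the count game within finitely many rounds. -/
theorem exists_winsIn_brieskornPham {m : ℕ} (p : ℕ) (hp : p.Prime) (k : Type) [Field k] [CharP k p] [IsAlgClosed k]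
    (u : Fin (m + 1) → MvPowerSeries (Fin (m + 1)) k) (hu : ∀ i, constantCoeff (u i) ≠ 0) (a : Fin (m + 1) → ℕ) (ha : ∀ i, 0 < a i)
    (hak : ∀ i, ((a i : ℕ) : k) ≠ 0) : ∃ n, WinsIn (m := m) GermIsNC n (∑ i, u i * X i ^ a i) :=
  totRungNonDegenerate m p hp k _ (brieskornPham_ne_zero u hu ha) (newtonNonDegenerate_brieskornPham u hu ha hak)

end NCTransport

end Summit.ResolutionOfSingularities.ResolutionOfSingularities.Theorems
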